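import Mathlib.Algebra.MvPolynomial.CommRing
import Mathlib.Algebra.MvPolynomial.Degrees
import Mathlib.Algebra.MvPolynomial.Variables
import Mathlib.RingTheory.MvPolynomial.WeightedHomogeneous
import Mathlib.Algebra.Polynomial.AlgebraMap
import Mathlib.Algebra.Polynomial.Degree.Lemmas
import Mathlib.Algebra.Polynomial.BigOperators
import Mathlib.Data.Fin.VecNotation
import HarnessLib

/-!
# Multi-parameter shifts restricted to a monomial curve: the identities `(E_N)` and the top slot coefficient
(instrument for the `W(f)` toy model — NOT a resolution theorem)

Generic commutative algebra (ours, bookkeeping over [Lang2002, Ch. IV §1] and [Matsumura1987, §27]) isolating the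
three formal ingredients of the engine's "THEOREM RZ" step (cell notes RE-DERIVATION-eng1-g41 §3.7.4), so that the
engine seat can cite checked lemmas instead of prose:

* `diag e` : the algebra map `MvPolynomial τ A →ₐ[A] A[X]`, `X t ↦ X ^ (e t)` (restriction to the monomial curve
  `σ ↦ (σ ^ e t)_t`).  `coeff_diag`: the `N`-th coefficient of `diag e F` is the sum of the coefficients of `F` over
  the exponents of `e`-weight `N`; hence (`sum_coeff_eq_zero_of_diag_eq_C`) if `diag e F` is a constant then every
  such sum with `N ≠ 0` vanishes — the identities `(E_N)`.  For two parameters of orders `(1, q)` the sums are made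
  explicit (`sum_filter_weight_eq_sum_range`, `(E_q)` = `coeff_add_coeff_eq_zero_of_diag_eq_C`,
  `(E_{q²})` = `sum_coeff_eq_zero_of_diag_eq_C_sq`).
* `multiShift v` : the universal multi-parameter shift `X j ↦ X j + Σ_t λ_t • v t j` with independent parameters
  `λ_t = X t`, valued in `MvPolynomial τ (MvPolynomial ι K)`; `orderShift e v` : the same shift along the curve
  `λ_t = σ ^ (e t)`, valued in `(MvPolynomial ι K)[X]`; `diag_multiShift` : `diag e ∘ multiShift v = orderShift e v`;
  `map_C_eq_orderShift` : a ring endomorphism `Φ` of `(MvPolynomial ι K)[X]` fixing `K` and sending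
  `C (X j) ↦ C (X j) + Σ_t X ^ (e t) * C (v t j)` acts on constants `C G` as `orderShift e v G`; so an isotropy
  equation `Φ (C G) = C G` yields `(E_N)` for the coefficients `Ψ_d := coeff d (multiShift v G)`
  (`sum_coeff_multiShift_eq_zero`).
* `Filt zw pw n F` : the two-level weight filtration "every coefficient of `λ^d` in `F` has all its monomials of
  `zw`-weight `≥ n + pw`-weight of `d`" (weights in any ordered additive commutative monoid `M`, e.g. `ℕ`, `ℤ`, `ℚ`;
  v2: v1 needlessly required a group); it is closed under `+`, `*`, sums, products and powers, and
  `filt_multiShift` : if every monomial of `v t j` has `zw`-weight `≥ zw j + pw t` and every monomial of `G` has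
  `zw`-weight `≥ n`, then `Filt zw pw n (multiShift v G)` ("`Ψ_{kl}` has `Z`-weight `≥ k d₁ + l d*`").
* `uni t₀` : kill every parameter but `t₀` (`coeff_uni`); `slotShift i α` : the one-parameter shift of the single
  slot `i` by `α`; `uni_multiShift` : if the `t₀`-column of `v` is concentrated in slot `i` with value `α` then
  `uni t₀ ∘ multiShift v = slotShift i α`; `coeff_slotShift_of_decomp` : if `G = X i ^ n * H + R` with `i ∉ H.vars`
  and `degreeOf i R < n` then the `n`-th coefficient of `slotShift i α G` is `H * α ^ n`
  ("`Ψ_{0,p} = [μ^p] g(f + μ α e₁) = c₁ α^p`").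
* `C_mul_pow_eq_neg_sum` assembles the three for two parameters of orders `(1, q)`:
  `H * α ^ q = - Σ_{l<q} Ψ_{(q(q-l), l)}`.

Dictionary to the cell's other instrument files (not imported here, so that this file builds on Mathlib alone):
`slotShift i α = PolyShift.polyShift (Pi.single i α)` and `orderShift`/`multiShift` specialise to
`DoubleShift.lineShift₂` for `τ = Fin 2`; `Filt zw pw n F` says `LeadingForm.WtGE zw (n + weight pw d) (coeff d F)`
for every `d`; the hypothesis `Φ (C G) = C G` is `IsotropyTwist.IsIsotropyOf G Φ`.

VALUE: bookkeeping for a toy model (Resolution Observatory cell `pub-rosobs`, carver lane gen 62; AI-written Lean, and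
AI review is weaker than expert review); nothing here is specific to resolution of singularities, NOT a statement
about the invariant of [AbramovichTemkinWlodarczyk2024], NOT progress on the summit, and no statement of the
literature is formalised beyond the elementary polynomial algebra of [Lang2002, Ch. IV §1].
-/

namespace Literature.AlgebraicGeometry.Resolution.WeightedBlowup

namespace MonomialCurve

open MvPolynomial
open scoped Pointwise

/-! ## Restriction to a monomial curve -/

section Diag

variable {A : Type*} [CommRing A] {τ : Type*}

/-- (ours, bookkeeping) Restriction of a polynomial in the parameters `X t` to the monomial curve `X t = σ ^ (e t)`:
the `A`-algebra map `X t ↦ X ^ (e t)` into `A[X]`. [cite: Lang2002, Ch. IV §1] -/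
noncomputable def diag (e : τ → ℕ) : MvPolynomial τ A →ₐ[A] Polynomial A :=
  aeval fun t => (Polynomial.X : Polynomial A) ^ e t

/-- (ours, bookkeeping) `diag` on a variable. [cite: Lang2002, Ch. IV §1] -/
@[simp] theorem diag_X (e : τ → ℕ) (t : τ) : diag e (X t : MvPolynomial τ A) = Polynomial.X ^ e t :=
  aeval_X _ t

/-- (ours, bookkeeping) `diag` on a constant. [cite: Lang2002, Ch. IV §1] -/
@[simp] theorem diag_C (e : τ → ℕ) (a : A) : diag e (C a : MvPolynomial τ A) = Polynomial.C a := by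
  rw [diag, aeval_C, ← Polynomial.C_eq_algebraMap]

/-- (ours, bookkeeping) `diag` on a monomial: `a • λ^d ↦ a • σ ^ (e-weight of d)`. [cite: Lang2002, Ch. IV §1] -/
theorem diag_monomial (e : τ → ℕ) (d : τ →₀ ℕ) (a : A) :
    diag e (monomial d a) = Polynomial.C a * Polynomial.X ^ Finsupp.weight e d := by
  rw [diag, aeval_monomial, ← Polynomial.C_eq_algebraMap]
  congr 1
  rw [Finsupp.weight_apply, Finsupp.prod, Finsupp.sum, ← Finset.prod_pow_eq_pow_sum]
  refine Finset.prod_congr rfl fun t _ => ?_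
  rw [← pow_mul, smul_eq_mul, mul_comm]

/-- (ours, bookkeeping) The `N`-th coefficient along the monomial curve is the sum of the coefficients over the
exponents of `e`-weight `N`. [cite: Lang2002, Ch. IV §1] -/
theorem coeff_diag (e : τ → ℕ) (F : MvPolynomial τ A) (N : ℕ) :
    (diag e F).coeff N = ∑ d ∈ F.support with Finsupp.weight e d = N, coeff d F := by
  classical
  conv_lhs => rw [F.as_sum, map_sum]
  rw [Polynomial.finsetSum_coeff, Finset.sum_filter]
  refine Finset.sum_congr rfl fun d _ => ?_
  rw [diag_monomial, Polynomial.coeff_C_mul_X_pow]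
  exact if_congr eq_comm rfl rfl

/-- (ours, bookkeeping) The identities `(E_N)`: if the restriction of `F` to the monomial curve is a constant, then
for every `N ≠ 0` the coefficients of `F` over the exponents of `e`-weight `N` sum to zero.
[cite: Lang2002, Ch. IV §1] -/
theorem sum_coeff_eq_zero_of_diag_eq_C (e : τ → ℕ) {F : MvPolynomial τ A} {a : A}
    (h : diag e F = Polynomial.C a) {N : ℕ} (hN : N ≠ 0) :
    ∑ d ∈ F.support with Finsupp.weight e d = N, coeff d F = 0 := by
  rw [← coeff_diag, h, Polynomial.coeff_C, if_neg hN]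

/-! ### Two parameters of orders `(1, q)` -/

/-- (ours, bookkeeping) The weight of an exponent in two variables. [cite: Lang2002, Ch. IV §1] -/
theorem weight_fin_two (a b : ℕ) (d : Fin 2 →₀ ℕ) : Finsupp.weight ![a, b] d = d 0 * a + d 1 * b := by
  simp [Finsupp.weight_apply, Finsupp.sum_fintype, Fin.sum_univ_two]

/-- (ours, bookkeeping) For orders `(1, q)`, `q ≠ 0`, the exponents of weight `N` are `(N - q l, l)`, `l ≤ N / q`:
the weight-`N` coefficient sum re-indexed by the second exponent. [cite: Lang2002, Ch. IV §1] -/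
theorem sum_filter_weight_eq_sum_range {q : ℕ} (hq : q ≠ 0) (F : MvPolynomial (Fin 2) A) (N : ℕ) :
    ∑ d ∈ F.support with Finsupp.weight ![1, q] d = N, coeff d F
      = ∑ l ∈ Finset.range (N / q + 1), coeff (Finsupp.single 0 (N - q * l) + Finsupp.single 1 l) F := by
  classical
  let φ : ℕ → (Fin 2 →₀ ℕ) := fun l => Finsupp.single 0 (N - q * l) + Finsupp.single 1 l
  have hφ0 : ∀ l, φ l 0 = N - q * l := fun l => by simp [φ]
  have hφ1 : ∀ l, φ l 1 = l := fun l => by simp [φ]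
  have hinj : Set.InjOn φ ↑(Finset.range (N / q + 1)) := fun l _ l' _ h => by
    have h1 := DFunLike.congr_fun h 1
    rwa [hφ1, hφ1] at h1
  change _ = ∑ l ∈ Finset.range (N / q + 1), coeff (φ l) F
  rw [← Finset.sum_image (f := fun d => coeff d F) hinj]
  apply Finset.sum_subset
  · intro d hd
    rw [Finset.mem_filter] at hd
    obtain ⟨hd, hw⟩ := hd
    rw [weight_fin_two, mul_one] at hw
    have hle : d 1 * q ≤ N := hw ▸ Nat.le_add_left (d 1 * q) (d 0)
    rw [Finset.mem_image]
    refine ⟨d 1, ?_, ?_⟩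
    · rw [Finset.mem_range, Nat.lt_succ_iff]
      exact (Nat.le_div_iff_mul_le (Nat.pos_of_ne_zero hq)).2 hle
    · ext i
      fin_cases i
      · show φ (d 1) 0 = d 0
        rw [hφ0]
        exact Nat.sub_eq_of_eq_add (by rw [← hw, mul_comm])
      · show φ (d 1) 1 = d 1
        rw [hφ1]
  · intro d hd hnot
    rw [Finset.mem_image] at hd
    obtain ⟨l, hl, rfl⟩ := hd
    have hle : q * l ≤ N := by
      rw [Finset.mem_range, Nat.lt_succ_iff, Nat.le_div_iff_mul_le (Nat.pos_of_ne_zero hq)] at hl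
      rwa [mul_comm] at hl
    have hw : Finsupp.weight ![1, q] (φ l) = N := by
      rw [weight_fin_two, hφ0, hφ1, mul_one, mul_comm l q]
      exact Nat.sub_add_cancel hle
    by_contra hne
    exact hnot (Finset.mem_filter.2 ⟨mem_support_iff.2 hne, hw⟩)

/-- (ours, bookkeeping) `(E_q)` for orders `(1, q)`: if the restriction to the curve `(σ, σ^q)` is constant then
`coeff (q, 0) F + coeff (0, 1) F = 0`. [cite: Lang2002, Ch. IV §1] -/
theorem coeff_add_coeff_eq_zero_of_diag_eq_C {q : ℕ} (hq : q ≠ 0) {F : MvPolynomial (Fin 2) A} {a : A}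
    (h : diag ![1, q] F = Polynomial.C a) :
    coeff (Finsupp.single 0 q) F + coeff (Finsupp.single 1 1) F = 0 := by
  have key := sum_coeff_eq_zero_of_diag_eq_C ![1, q] h hq
  rw [sum_filter_weight_eq_sum_range hq, Nat.div_self (Nat.pos_of_ne_zero hq), Finset.sum_range_succ,
    Finset.sum_range_one] at key
  simpa using key

/-- (ours, bookkeeping) `(E_{q²})` for orders `(1, q)`: if the restriction to the curve `(σ, σ^q)` is constant then
`Σ_{l ≤ q} coeff (q (q - l), l) F = 0`. [cite: Lang2002, Ch. IV §1] -/
theorem sum_coeff_eq_zero_of_diag_eq_C_sq {q : ℕ} (hq : q ≠ 0) {F : MvPolynomial (Fin 2) A} {a : A}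
    (h : diag ![1, q] F = Polynomial.C a) :
    ∑ l ∈ Finset.range (q + 1), coeff (Finsupp.single 0 (q * q - q * l) + Finsupp.single 1 l) F = 0 := by
  have key := sum_coeff_eq_zero_of_diag_eq_C ![1, q] h (mul_ne_zero hq hq)
  rwa [sum_filter_weight_eq_sum_range hq, Nat.mul_div_cancel_left q (Nat.pos_of_ne_zero hq)] at key

/-- (ours, bookkeeping) `(E_{q²})` solved for its top term: `coeff (0, q) F = - Σ_{l < q} coeff (q (q - l), l) F`.
[cite: Lang2002, Ch. IV §1] -/
theorem coeff_single_eq_neg_sum_of_diag_eq_C {q : ℕ} (hq : q ≠ 0) {F : MvPolynomial (Fin 2) A} {a : A}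
    (h : diag ![1, q] F = Polynomial.C a) :
    coeff (Finsupp.single 1 q) F
      = - ∑ l ∈ Finset.range q, coeff (Finsupp.single 0 (q * q - q * l) + Finsupp.single 1 l) F := by
  have key := sum_coeff_eq_zero_of_diag_eq_C_sq hq h
  rw [Finset.sum_range_succ, Nat.sub_self, Finsupp.single_zero, zero_add] at key
  exact eq_neg_of_add_eq_zero_right key

/-- (ours, bookkeeping) Ideal form of the previous lemma: if the lower terms `coeff (q (q - l), l) F`, `l < q`, lie in
an ideal `I`, so does the top term `coeff (0, q) F`. [cite: Lang2002, Ch. IV §1] -/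
theorem coeff_single_mem_of_diag_eq_C {q : ℕ} (hq : q ≠ 0) {F : MvPolynomial (Fin 2) A} {a : A}
    (h : diag ![1, q] F = Polynomial.C a) (I : Ideal A)
    (hI : ∀ l < q, coeff (Finsupp.single 0 (q * q - q * l) + Finsupp.single 1 l) F ∈ I) :
    coeff (Finsupp.single 1 q) F ∈ I := by
  rw [coeff_single_eq_neg_sum_of_diag_eq_C hq h]
  exact I.neg_mem (I.sum_mem fun l hl => hI l (Finset.mem_range.1 hl))

end Diag

/-! ## The universal multi-parameter shift and its restriction to a monomial curve -/

section Shift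

variable {K : Type*} [CommRing K] {ι τ : Type*} [Fintype τ]

/-- (ours, bookkeeping) The universal shift `X j ↦ X j + Σ_t λ_t • v t j` with independent parameters `λ_t = X t`,
as a `K`-algebra map into `MvPolynomial τ (MvPolynomial ι K)`. [cite: Lang2002, Ch. IV §1] -/
noncomputable def multiShift (v : τ → ι → MvPolynomial ι K) :
    MvPolynomial ι K →ₐ[K] MvPolynomial τ (MvPolynomial ι K) :=
  aeval fun j => C (X j) + ∑ t, X t * C (v t j)

/-- (ours, bookkeeping) `multiShift` on a variable. [cite: Lang2002, Ch. IV §1] -/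
@[simp] theorem multiShift_X (v : τ → ι → MvPolynomial ι K) (j : ι) :
    multiShift v (X j) = C (X j) + ∑ t, X t * C (v t j) :=
  aeval_X _ j

/-- (ours, bookkeeping) `multiShift` fixes scalars. [cite: Lang2002, Ch. IV §1] -/
@[simp] theorem multiShift_C (v : τ → ι → MvPolynomial ι K) (c : K) :
    multiShift v (C c : MvPolynomial ι K) = C (C c) := by
  rw [multiShift, aeval_C, IsScalarTower.algebraMap_apply K (MvPolynomial ι K) (MvPolynomial τ (MvPolynomial ι K)),
    MvPolynomial.algebraMap_eq, MvPolynomial.algebraMap_eq]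

/-- (ours, bookkeeping) The shift along the monomial curve `λ_t = σ ^ (e t)`:
`X j ↦ X j + Σ_t σ ^ (e t) • v t j`, valued in `(MvPolynomial ι K)[X]`. [cite: Lang2002, Ch. IV §1] -/
noncomputable def orderShift (e : τ → ℕ) (v : τ → ι → MvPolynomial ι K) :
    MvPolynomial ι K →ₐ[K] Polynomial (MvPolynomial ι K) :=
  aeval fun j => Polynomial.C (X j) + ∑ t, Polynomial.X ^ e t * Polynomial.C (v t j)

/-- (ours, bookkeeping) `orderShift` on a variable. [cite: Lang2002, Ch. IV §1] -/
@[simp] theorem orderShift_X (e : τ → ℕ) (v : τ → ι → MvPolynomial ι K) (j : ι) :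
    orderShift e v (X j) = Polynomial.C (X j) + ∑ t, Polynomial.X ^ e t * Polynomial.C (v t j) :=
  aeval_X _ j

/-- (ours, bookkeeping) `orderShift` fixes scalars. [cite: Lang2002, Ch. IV §1] -/
@[simp] theorem orderShift_C (e : τ → ℕ) (v : τ → ι → MvPolynomial ι K) (c : K) :
    orderShift e v (C c : MvPolynomial ι K) = Polynomial.C (C c) := by
  rw [orderShift, aeval_C, IsScalarTower.algebraMap_apply K (MvPolynomial ι K) (Polynomial (MvPolynomial ι K)),
    MvPolynomial.algebraMap_eq, ← Polynomial.C_eq_algebraMap]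

/-- (ours, bookkeeping) Restricting the universal shift to the monomial curve gives the shift along the curve:
`diag e ∘ multiShift v = orderShift e v`. [cite: Lang2002, Ch. IV §1] -/
theorem diag_multiShift (e : τ → ℕ) (v : τ → ι → MvPolynomial ι K) (G : MvPolynomial ι K) :
    diag e (multiShift v G) = orderShift e v G := by
  have key : ((diag (A := MvPolynomial ι K) e).restrictScalars K).comp (multiShift v) = orderShift e v := by
    refine MvPolynomial.algHom_ext fun j => ?_
    simp only [AlgHom.comp_apply, AlgHom.restrictScalars_apply, multiShift_X, orderShift_X, map_add, map_sum,
      map_mul, diag_C, diag_X]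
  exact DFunLike.congr_fun key G

/-- (ours, bookkeeping) A ring endomorphism `Φ` of `(MvPolynomial ι K)[X]` fixing the scalars `K` and sending each
`C (X j)` to `C (X j) + Σ_t X ^ (e t) * C (v t j)` acts on every constant `C G` as `orderShift e v G`.
[cite: Lang2002, Ch. IV §1] -/
theorem map_C_eq_orderShift (e : τ → ℕ) (v : τ → ι → MvPolynomial ι K)
    (Φ : Polynomial (MvPolynomial ι K) →+* Polynomial (MvPolynomial ι K))
    (hC : ∀ c : K, Φ (Polynomial.C (C c)) = Polynomial.C (C c))
    (hX : ∀ j, Φ (Polynomial.C (X j)) = Polynomial.C (X j) + ∑ t, Polynomial.X ^ e t * Polynomial.C (v t j))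
    (G : MvPolynomial ι K) : Φ (Polynomial.C G) = orderShift e v G := by
  have key : Φ.comp Polynomial.C = (orderShift e v : MvPolynomial ι K →ₐ[K] _).toRingHom := by
    refine MvPolynomial.ringHom_ext (fun c => ?_) (fun j => ?_)
    · simp only [RingHom.comp_apply, hC, AlgHom.toRingHom_eq_coe, RingHom.coe_coe, orderShift_C]
    · simp only [RingHom.comp_apply, hX, AlgHom.toRingHom_eq_coe, RingHom.coe_coe, orderShift_X]
  exact DFunLike.congr_fun key G

/-- (ours, bookkeeping) `(E_N)` for isotropies: if such a `Φ` fixes `C G`, then for every `N ≠ 0` the coefficients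
`Ψ_d := coeff d (multiShift v G)` over the exponents `d` of `e`-weight `N` sum to zero.
[cite: Lang2002, Ch. IV §1] -/
theorem sum_coeff_multiShift_eq_zero (e : τ → ℕ) (v : τ → ι → MvPolynomial ι K)
    (Φ : Polynomial (MvPolynomial ι K) →+* Polynomial (MvPolynomial ι K))
    (hC : ∀ c : K, Φ (Polynomial.C (C c)) = Polynomial.C (C c))
    (hX : ∀ j, Φ (Polynomial.C (X j)) = Polynomial.C (X j) + ∑ t, Polynomial.X ^ e t * Polynomial.C (v t j))
    {G : MvPolynomial ι K} (hG : Φ (Polynomial.C G) = Polynomial.C G) {N : ℕ} (hN : N ≠ 0) :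
    ∑ d ∈ (multiShift v G).support with Finsupp.weight e d = N, coeff d (multiShift v G) = 0 :=
  sum_coeff_eq_zero_of_diag_eq_C e (by rw [diag_multiShift, ← map_C_eq_orderShift e v Φ hC hX G, hG]) hN

end Shift

/-! ## The two-level weight filtration -/

section Filtration

variable {K : Type*} [CommRing K] {ι τ : Type*}
variable {M : Type*} [AddCommMonoid M] [PartialOrder M] [IsOrderedAddMonoid M]

/-- (ours, bookkeeping) `Filt zw pw n F`: for every exponent `d` of the parameters, every monomial `m` of the
coefficient `coeff d F ∈ MvPolynomial ι K` has `zw`-weight at least `n + (pw-weight of d)` — the parameters `λ_t`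
carry weight `pw t`, the variables `X j` weight `zw j`, and `F` has total weight `≥ n`.
[cite: Matsumura1987, §27 (p. 207)] -/
def Filt (zw : ι → M) (pw : τ → M) (n : M) (F : MvPolynomial τ (MvPolynomial ι K)) : Prop :=
  ∀ d, ∀ m ∈ (coeff d F).support, n + Finsupp.weight pw d ≤ Finsupp.weight zw m

variable {zw : ι → M} {pw : τ → M}

omit [IsOrderedAddMonoid M] in
/-- (ours, bookkeeping) `0` lies in every filtration step. [cite: Matsumura1987, §27 (p. 207)] -/
theorem filt_zero (n : M) : Filt zw pw n (0 : MvPolynomial τ (MvPolynomial ι K)) :=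
  fun d m hm => by simp at hm

/-- (ours, bookkeeping) The filtration is decreasing. [cite: Matsumura1987, §27 (p. 207)] -/
theorem Filt.mono {n n' : M} {F : MvPolynomial τ (MvPolynomial ι K)} (h : Filt zw pw n F) (hn : n' ≤ n) :
    Filt zw pw n' F :=
  fun d m hm => (add_le_add hn le_rfl).trans (h d m hm)

omit [IsOrderedAddMonoid M] in
/-- (ours, bookkeeping) Closure under addition. [cite: Matsumura1987, §27 (p. 207)] -/
theorem Filt.add {n : M} {F G : MvPolynomial τ (MvPolynomial ι K)} (hF : Filt zw pw n F) (hG : Filt zw pw n G) :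
    Filt zw pw n (F + G) := by
  classical
  intro d m hm
  rw [coeff_add] at hm
  rcases Finset.mem_union.1 (support_add hm) with h | h
  exacts [hF d m h, hG d m h]

omit [IsOrderedAddMonoid M] in
/-- (ours, bookkeeping) Closure under finite sums. [cite: Matsumura1987, §27 (p. 207)] -/
theorem Filt.sum {α : Type*} (s : Finset α) {n : M} {F : α → MvPolynomial τ (MvPolynomial ι K)}
    (h : ∀ a ∈ s, Filt zw pw n (F a)) : Filt zw pw n (∑ a ∈ s, F a) := by
  classical
  induction s using Finset.induction_on with
  | empty => simpa using filt_zero n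
  | insert a s ha ih =>
    rw [Finset.sum_insert ha]
    exact (h a (Finset.mem_insert_self a s)).add (ih fun b hb => h b (Finset.mem_insert_of_mem hb))

/-- (ours, bookkeeping) Multiplicativity: steps `n` and `n'` multiply into step `n + n'`.
[cite: Matsumura1987, §27 (p. 207)] -/
theorem Filt.mul {n n' : M} {F G : MvPolynomial τ (MvPolynomial ι K)} (hF : Filt zw pw n F)
    (hG : Filt zw pw n' G) : Filt zw pw (n + n') (F * G) := by
  classical
  intro d m hm
  rw [coeff_mul] at hm
  obtain ⟨x, hx, hm⟩ : ∃ x ∈ Finset.antidiagonal d, m ∈ (coeff x.1 F * coeff x.2 G).support := by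
    simpa only [Finset.mem_biUnion] using support_sum hm
  obtain ⟨m₁, hm₁, m₂, hm₂, rfl⟩ := Finset.mem_add.1 (support_mul _ _ hm)
  rw [Finset.mem_antidiagonal] at hx
  rw [← hx, map_add, map_add]
  calc n + n' + (Finsupp.weight pw x.1 + Finsupp.weight pw x.2)
      = (n + Finsupp.weight pw x.1) + (n' + Finsupp.weight pw x.2) := by abel
    _ ≤ Finsupp.weight zw m₁ + Finsupp.weight zw m₂ := add_le_add (hF _ _ hm₁) (hG _ _ hm₂)

omit [IsOrderedAddMonoid M] in
/-- (ours, bookkeeping) A constant `C a` lies in step `n` as soon as every monomial of `a` has weight `≥ n`.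
[cite: Matsumura1987, §27 (p. 207)] -/
theorem filt_C {a : MvPolynomial ι K} {n : M} (ha : ∀ m ∈ a.support, n ≤ Finsupp.weight zw m) :
    Filt zw pw n (C a : MvPolynomial τ (MvPolynomial ι K)) := by
  classical
  intro d m hm
  rw [coeff_C] at hm
  split_ifs at hm with hd
  · subst hd
    rw [map_zero, add_zero]
    exact ha m hm
  · simp at hm

omit [IsOrderedAddMonoid M] in
/-- (ours, bookkeeping) `1` lies in step `0`. [cite: Matsumura1987, §27 (p. 207)] -/
theorem filt_one : Filt zw pw 0 (1 : MvPolynomial τ (MvPolynomial ι K)) := by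
  rw [← C_1]
  refine filt_C fun m hm => ?_
  classical
  rw [← C_1, support_C] at hm
  split_ifs at hm with h1
  · simp at hm
  · rw [Finset.mem_singleton.1 hm, map_zero]

/-- (ours, bookkeeping) Closure under finite products, with additive bookkeeping of the steps.
[cite: Matsumura1987, §27 (p. 207)] -/
theorem Filt.prod {α : Type*} (s : Finset α) {u : α → M} {F : α → MvPolynomial τ (MvPolynomial ι K)}
    (h : ∀ a ∈ s, Filt zw pw (u a) (F a)) : Filt zw pw (∑ a ∈ s, u a) (∏ a ∈ s, F a) := by
  classical
  induction s using Finset.induction_on with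
  | empty => simpa using (filt_one (zw := zw) (pw := pw) (K := K))
  | insert a s ha ih =>
    rw [Finset.sum_insert ha, Finset.prod_insert ha]
    exact (h a (Finset.mem_insert_self a s)).mul (ih fun b hb => h b (Finset.mem_insert_of_mem hb))

/-- (ours, bookkeeping) Closure under powers. [cite: Matsumura1987, §27 (p. 207)] -/
theorem Filt.pow {n : M} {F : MvPolynomial τ (MvPolynomial ι K)} (hF : Filt zw pw n F) (k : ℕ) :
    Filt zw pw (k • n) (F ^ k) := by
  have := Filt.prod (Finset.range k) (u := fun _ => n) (F := fun _ => F) fun _ _ => hF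
  simpa using this

omit [IsOrderedAddMonoid M] in
/-- (ours, bookkeeping) The parameter monomial `λ_t • a` lies in step `n` as soon as every monomial of `a` has weight
`≥ n + pw t`. [cite: Matsumura1987, §27 (p. 207)] -/
theorem filt_X_mul_C {t : τ} {a : MvPolynomial ι K} {n : M}
    (ha : ∀ m ∈ a.support, n + pw t ≤ Finsupp.weight zw m) :
    Filt zw pw n (X t * C a : MvPolynomial τ (MvPolynomial ι K)) := by
  classical
  intro d m hm
  rw [X, C_apply, monomial_mul, coeff_monomial] at hm
  split_ifs at hm with hd
  · subst hd
    rw [add_zero, Finsupp.weight_single, one_smul]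
    rw [one_mul] at hm
    exact ha m hm
  · simp at hm

omit [IsOrderedAddMonoid M] in
/-- (ours, bookkeeping) The image of a variable under the universal shift lies in step `zw j`, provided every
monomial of `v t j` has weight `≥ zw j + pw t` ("the shift data respect the weights").
[cite: Matsumura1987, §27 (p. 207)] -/
theorem filt_multiShift_X [Fintype τ] {v : τ → ι → MvPolynomial ι K}
    (hv : ∀ t j, ∀ m ∈ (v t j).support, zw j + pw t ≤ Finsupp.weight zw m) (j : ι) :
    Filt zw pw (zw j) (multiShift v (X j)) := by
  classical
  rw [multiShift_X]
  refine (filt_C fun m hm => ?_).add (Filt.sum _ fun t _ => filt_X_mul_C (hv t j))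
  have hm' := support_monomial_subset hm
  rw [Finset.mem_singleton] at hm'
  rw [hm', Finsupp.weight_single, one_smul]

/-- (ours, bookkeeping) `multiShift` on a monomial: `c • X^m₀ ↦ c • Π_j (multiShift v (X j)) ^ (m₀ j)`.
[cite: Lang2002, Ch. IV §1] -/
theorem multiShift_monomial [Fintype τ] (v : τ → ι → MvPolynomial ι K) (m₀ : ι →₀ ℕ) (c : K) :
    multiShift v (monomial m₀ c) = C (C c) * m₀.prod fun j k => multiShift v (X j) ^ k := by
  rw [monomial_eq, map_mul, multiShift_C, map_finsuppProd]
  simp only [map_pow]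

/-- (ours, bookkeeping) MAIN FILTRATION LEMMA: if the shift data respect the weights and every monomial of `G` has
`zw`-weight `≥ n`, then `multiShift v G` lies in step `n`: the coefficient `Ψ_d` of `λ^d` has all its monomials of
`zw`-weight `≥ n + pw-weight of d`. [cite: Matsumura1987, §27 (p. 207)] -/
theorem filt_multiShift [Fintype τ] {v : τ → ι → MvPolynomial ι K}
    (hv : ∀ t j, ∀ m ∈ (v t j).support, zw j + pw t ≤ Finsupp.weight zw m) {G : MvPolynomial ι K} {n : M}
    (hG : ∀ m ∈ G.support, n ≤ Finsupp.weight zw m) : Filt zw pw n (multiShift v G) := by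
  classical
  rw [G.as_sum, map_sum]
  refine Filt.sum _ fun m₀ hm₀ => ?_
  rw [multiShift_monomial]
  have h1 : Filt zw pw 0 (C (C (coeff m₀ G)) : MvPolynomial τ (MvPolynomial ι K)) := by
    refine filt_C fun m hm => ?_
    have hm' := support_monomial_subset (by rwa [C_apply] at hm)
    rw [Finset.mem_singleton] at hm'
    rw [hm', map_zero]
  have h2 : Filt zw pw (Finsupp.weight zw m₀) (m₀.prod fun j k => multiShift v (X j) ^ k) := by
    rw [Finsupp.weight_apply, Finsupp.prod, Finsupp.sum]
    exact Filt.prod _ fun j _ => (filt_multiShift_X hv j).pow (m₀ j)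
  refine (h1.mul h2).mono ?_
  rw [zero_add]
  exact hG m₀ hm₀

/-- (ours, bookkeeping) `ℕ`-valued weights, two parameters of parameter weights `(d₁, d*)`: if the blocks `v 0 j`
(resp. `v 1 j`) have all their monomials of weight `≥ zw j + d₁` (resp. `≥ zw j + d*`), then every monomial of
`Ψ_d = coeff d (multiShift v G)` has `zw`-weight `≥ d 0 * d₁ + d 1 * d*` ("`Ψ_{kl}` has `Z`-weight `≥ k d₁ + l d*`").
[cite: Matsumura1987, §27 (p. 207)] -/
theorem le_weight_of_mem_support_coeff_multiShift {zw : ι → ℕ} {d₁ dstar : ℕ}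
    {v : Fin 2 → ι → MvPolynomial ι K}
    (hv0 : ∀ j, ∀ m ∈ (v 0 j).support, zw j + d₁ ≤ Finsupp.weight zw m)
    (hv1 : ∀ j, ∀ m ∈ (v 1 j).support, zw j + dstar ≤ Finsupp.weight zw m) (G : MvPolynomial ι K)
    (d : Fin 2 →₀ ℕ) {m : ι →₀ ℕ} (hm : m ∈ (coeff d (multiShift v G)).support) :
    d 0 * d₁ + d 1 * dstar ≤ Finsupp.weight zw m := by
  have hv : ∀ t j, ∀ m ∈ (v t j).support, zw j + (![d₁, dstar] : Fin 2 → ℕ) t ≤ Finsupp.weight zw m := by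
    intro t j m hm
    fin_cases t
    · simpa using hv0 j m hm
    · simpa using hv1 j m hm
  have h := filt_multiShift (pw := ![d₁, dstar]) (n := 0) hv (G := G) (fun m _ => Nat.zero_le _) d m hm
  rwa [zero_add, weight_fin_two] at h

end Filtration

/-! ## One parameter at a time: the face `λ = λ_{t₀}` and the top slot coefficient -/

section Face

variable {A : Type*} [CommRing A] {τ : Type*} [DecidableEq τ]

/-- (ours, bookkeeping) Kill every parameter except `t₀`: the `A`-algebra map `X t₀ ↦ X`, `X t ↦ 0` (`t ≠ t₀`) into
`A[X]`. [cite: Lang2002, Ch. IV §1] -/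
noncomputable def uni (t₀ : τ) : MvPolynomial τ A →ₐ[A] Polynomial A :=
  aeval fun t => if t = t₀ then (Polynomial.X : Polynomial A) else 0

/-- (ours, bookkeeping) `uni` on a variable. [cite: Lang2002, Ch. IV §1] -/
@[simp] theorem uni_X (t₀ t : τ) :
    uni t₀ (X t : MvPolynomial τ A) = if t = t₀ then (Polynomial.X : Polynomial A) else 0 :=
  aeval_X _ t

/-- (ours, bookkeeping) `uni` on a constant. [cite: Lang2002, Ch. IV §1] -/
@[simp] theorem uni_C (t₀ : τ) (a : A) : uni t₀ (C a : MvPolynomial τ A) = Polynomial.C a := by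
  rw [uni, aeval_C, ← Polynomial.C_eq_algebraMap]

/-- (ours, bookkeeping) `uni` on a monomial: pure powers of `λ_{t₀}` survive, mixed monomials die.
[cite: Lang2002, Ch. IV §1] -/
theorem uni_monomial (t₀ : τ) (d : τ →₀ ℕ) (a : A) :
    uni t₀ (monomial d a)
      = if d = Finsupp.single t₀ (d t₀) then Polynomial.C a * Polynomial.X ^ d t₀ else 0 := by
  rw [uni, aeval_monomial, ← Polynomial.C_eq_algebraMap]
  split_ifs with h
  · conv_lhs => rw [h]
    rw [Finsupp.prod_single_index (by simp), if_pos rfl]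
  · obtain ⟨t, ht, htne⟩ : ∃ t ∈ d.support, t ≠ t₀ := by
      by_contra hcon
      refine h (Finsupp.support_subset_singleton.1 fun t ht => Finset.mem_singleton.2 ?_)
      by_contra htne
      exact hcon ⟨t, ht, htne⟩
    rw [Finsupp.prod, Finset.prod_eq_zero ht, mul_zero]
    rw [if_neg htne, zero_pow (Finsupp.mem_support_iff.1 ht)]

/-- (ours, bookkeeping) The `n`-th coefficient after killing the other parameters is the coefficient of the pure
power `λ_{t₀} ^ n`. [cite: Lang2002, Ch. IV §1] -/
theorem coeff_uni (t₀ : τ) (F : MvPolynomial τ A) (n : ℕ) :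
    (uni t₀ F).coeff n = coeff (Finsupp.single t₀ n) F := by
  conv_lhs => rw [F.as_sum, map_sum]
  rw [Polynomial.finsetSum_coeff, Finset.sum_eq_single (Finsupp.single t₀ n)]
  · rw [uni_monomial, if_pos (by simp), Finsupp.single_eq_same, Polynomial.coeff_C_mul_X_pow, if_pos rfl]
  · intro d _ hne
    rw [uni_monomial]
    split_ifs with h
    · rw [Polynomial.coeff_C_mul_X_pow, if_neg]
      intro hn
      exact hne (by rw [h, ← hn])
    · exact Polynomial.coeff_zero n
  · intro hnot
    rw [notMem_support_iff.1 hnot, map_zero, map_zero, Polynomial.coeff_zero]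

end Face

section Slot

variable {K : Type*} [CommRing K] {ι : Type*} [DecidableEq ι]

/-- (ours, bookkeeping) The one-parameter shift of the single slot `i` by `α`: `X i ↦ X i + λ α`, `X j ↦ X j`
(`j ≠ i`), valued in `(MvPolynomial ι K)[X]` with `λ = X`.  (Dictionary: this is the cell's
`PolyShift.polyShift (Pi.single i α)`.) [cite: Lang2002, Ch. IV §1] -/
noncomputable def slotShift (i : ι) (α : MvPolynomial ι K) : MvPolynomial ι K →ₐ[K] Polynomial (MvPolynomial ι K) :=
  aeval fun j => Polynomial.C (X j) + if j = i then Polynomial.X * Polynomial.C α else 0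

/-- (ours, bookkeeping) `slotShift` on a variable. [cite: Lang2002, Ch. IV §1] -/
@[simp] theorem slotShift_X (i : ι) (α : MvPolynomial ι K) (j : ι) :
    slotShift i α (X j) = Polynomial.C (X j) + if j = i then Polynomial.X * Polynomial.C α else 0 :=
  aeval_X _ j

/-- (ours, bookkeeping) `slotShift` fixes scalars. [cite: Lang2002, Ch. IV §1] -/
@[simp] theorem slotShift_C (i : ι) (α : MvPolynomial ι K) (c : K) :
    slotShift i α (C c : MvPolynomial ι K) = Polynomial.C (C c) := by
  rw [slotShift, aeval_C, IsScalarTower.algebraMap_apply K (MvPolynomial ι K) (Polynomial (MvPolynomial ι K)),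
    MvPolynomial.algebraMap_eq, ← Polynomial.C_eq_algebraMap]

/-- (ours, bookkeeping) A polynomial not involving the slot `i` is not moved. [cite: Lang2002, Ch. IV §1] -/
theorem slotShift_eq_C_of_notMem_vars (i : ι) (α : MvPolynomial ι K) {H : MvPolynomial ι K} (hH : i ∉ H.vars) :
    slotShift i α H = Polynomial.C H := by
  have key := MvPolynomial.hom_congr_vars (f₁ := (slotShift i α : MvPolynomial ι K →ₐ[K] _).toRingHom)
    (f₂ := (Polynomial.C : MvPolynomial ι K →+* Polynomial (MvPolynomial ι K))) (p₁ := H) (p₂ := H)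
    (by
      refine RingHom.ext fun c => ?_
      simp only [RingHom.comp_apply, AlgHom.toRingHom_eq_coe, RingHom.coe_coe, slotShift_C])
    (fun j hj _ => by
      have hji : j ≠ i := fun h => hH (h ▸ hj)
      simp only [AlgHom.toRingHom_eq_coe, RingHom.coe_coe, slotShift_X, if_neg hji, add_zero])
    rfl
  simpa only [AlgHom.toRingHom_eq_coe, RingHom.coe_coe] using key

/-- (ours, bookkeeping) Degree bound: the `λ`-degree of `slotShift i α R` is at most the degree of `R` in the slot
`i`. [cite: Lang2002, Ch. IV §1] -/
theorem natDegree_slotShift_le (i : ι) (α R : MvPolynomial ι K) : (slotShift i α R).natDegree ≤ degreeOf i R := by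
  have hgen : ∀ j, (slotShift i α (X j)).natDegree ≤ if j = i then 1 else 0 := by
    intro j
    rw [slotShift_X]
    split_ifs with h
    · refine (Polynomial.natDegree_add_le _ _).trans (max_le ?_ ?_)
      · rw [Polynomial.natDegree_C]
        exact Nat.zero_le 1
      · exact (Polynomial.natDegree_mul_C_le _ _).trans Polynomial.natDegree_X_le
    · rw [add_zero, Polynomial.natDegree_C]
  conv_lhs => rw [R.as_sum, map_sum]
  refine Polynomial.natDegree_sum_le_of_forall_le _ _ fun d hd => ?_
  refine le_trans ?_ (monomial_le_degreeOf i hd)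
  rw [monomial_eq, map_mul, slotShift_C, map_finsuppProd, Finsupp.prod]
  refine (Polynomial.natDegree_C_mul_le _ _).trans ((Polynomial.natDegree_prod_le _ _).trans ?_)
  calc ∑ j ∈ d.support, (slotShift i α (X j ^ d j)).natDegree
      ≤ ∑ j ∈ d.support, (if j = i then d j else 0) := Finset.sum_le_sum fun j _ => by
        rw [map_pow]
        refine Polynomial.natDegree_pow_le.trans ?_
        refine (Nat.mul_le_mul_left (d j) (hgen j)).trans ?_
        split_ifs <;> simp
    _ = if i ∈ d.support then d i else 0 := Finset.sum_ite_eq' _ _ _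
    _ ≤ d i := by split_ifs <;> simp

/-- (ours, bookkeeping) Coefficients beyond the slot degree vanish. [cite: Lang2002, Ch. IV §1] -/
theorem coeff_slotShift_eq_zero (i : ι) (α : MvPolynomial ι K) {R : MvPolynomial ι K} {m : ℕ}
    (hR : degreeOf i R < m) : (slotShift i α R).coeff m = 0 :=
  Polynomial.coeff_eq_zero_of_natDegree_lt ((natDegree_slotShift_le i α R).trans_lt hR)

/-- (ours, bookkeeping) The top coefficient of the shifted pure power: `[λ^n] (X i + λ α)^n = α^n`.
[cite: Lang2002, Ch. IV §1] -/
theorem coeff_slotShift_X_pow (i : ι) (α : MvPolynomial ι K) (n : ℕ) :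
    (slotShift i α (X i ^ n)).coeff n = α ^ n := by
  rw [map_pow, slotShift_X, if_pos rfl]
  have h1 : (Polynomial.C (X i) + Polynomial.X * Polynomial.C α).natDegree ≤ 1 := by
    refine (Polynomial.natDegree_add_le _ _).trans (max_le ?_ ?_)
    · rw [Polynomial.natDegree_C]
      exact Nat.zero_le 1
    · exact (Polynomial.natDegree_mul_C_le _ _).trans Polynomial.natDegree_X_le
  have key := Polynomial.coeff_pow_of_natDegree_le (m := n) h1
  rw [mul_one] at key
  rw [key, Polynomial.coeff_add, Polynomial.coeff_C, if_neg one_ne_zero, zero_add,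
    show (1 : ℕ) = 0 + 1 from rfl, Polynomial.coeff_X_mul, Polynomial.coeff_C_zero]

/-- (ours, bookkeeping) TOP SLOT COEFFICIENT: if `G = X i ^ n * H + R` with `H` free of the slot `i` and
`degreeOf i R < n`, then `[λ^n] slotShift i α G = H * α ^ n` ("`Ψ_{0,p} = [μ^p] g(f + μ α e₁) = c₁ α^p`").
[cite: Lang2002, Ch. IV §1] -/
theorem coeff_slotShift_of_decomp (i : ι) (α : MvPolynomial ι K) {G H R : MvPolynomial ι K} {n : ℕ}
    (hG : G = X i ^ n * H + R) (hH : i ∉ H.vars) (hR : degreeOf i R < n) :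
    (slotShift i α G).coeff n = H * α ^ n := by
  rw [hG, map_add, map_mul, slotShift_eq_C_of_notMem_vars i α hH, Polynomial.coeff_add, Polynomial.coeff_mul_C,
    coeff_slotShift_X_pow, coeff_slotShift_eq_zero i α hR, add_zero, mul_comm]

/-- (ours, bookkeeping) Killing every parameter but `t₀` in the universal shift gives the one-slot shift, provided
the `t₀`-column of the shift data is concentrated in the slot `i` with value `α`. [cite: Lang2002, Ch. IV §1] -/
theorem uni_multiShift {τ : Type*} [Fintype τ] [DecidableEq τ] (t₀ : τ) (v : τ → ι → MvPolynomial ι K) {i : ι}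
    {α : MvPolynomial ι K} (hv : ∀ j, v t₀ j = if j = i then α else 0) (G : MvPolynomial ι K) :
    uni t₀ (multiShift v G) = slotShift i α G := by
  have key : ((uni (A := MvPolynomial ι K) t₀).restrictScalars K).comp (multiShift v) = slotShift i α := by
    refine MvPolynomial.algHom_ext fun j => ?_
    simp only [AlgHom.comp_apply, AlgHom.restrictScalars_apply, multiShift_X, map_add, map_sum, map_mul, uni_C,
      uni_X, ite_mul, zero_mul, Finset.sum_ite_eq', Finset.mem_univ, if_true, slotShift_X, hv j]
    split_ifs <;> simp
  exact DFunLike.congr_fun key G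

/-- (ours, bookkeeping) Hence the pure `λ_{t₀} ^ n` coefficient of the universal shift is the top slot coefficient:
`coeff (n • e_{t₀}) (multiShift v G) = H * α ^ n` under the hypotheses of `coeff_slotShift_of_decomp`.
[cite: Lang2002, Ch. IV §1] -/
theorem coeff_multiShift_single {τ : Type*} [Fintype τ] [DecidableEq τ] (t₀ : τ) (v : τ → ι → MvPolynomial ι K)
    {i : ι} {α : MvPolynomial ι K} (hv : ∀ j, v t₀ j = if j = i then α else 0) {G H R : MvPolynomial ι K} {n : ℕ}
    (hG : G = X i ^ n * H + R) (hH : i ∉ H.vars) (hR : degreeOf i R < n) :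
    coeff (Finsupp.single t₀ n) (multiShift v G) = H * α ^ n := by
  rw [← coeff_uni, uni_multiShift t₀ v hv, coeff_slotShift_of_decomp i α hG hH hR]

end Slot

/-! ## Assembly for two parameters of orders `(1, q)` -/

section Assembly

variable {K : Type*} [CommRing K] {ι : Type*} [DecidableEq ι]

/-- (ours, bookkeeping) THE `RZ`-TYPE IDENTITY.  Two parameters `(λ, μ) = (σ, σ^q)`, `q ≠ 0`; the `μ`-column of the
shift data is concentrated in the slot `i` with value `α`; `G = X i ^ q * H + R` with `H` free of the slot `i` and
`degreeOf i R < q`; and a ring endomorphism `Φ` of `(MvPolynomial ι K)[X]` fixing `K`, acting on the variables by the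
shift along the curve, and fixing `C G`.  Then `H * α ^ q = - Σ_{l<q} Ψ_{(q(q-l), l)}` where
`Ψ_d = coeff d (multiShift v G)`. [cite: Lang2002, Ch. IV §1] -/
theorem mul_pow_eq_neg_sum {q : ℕ} (hq : q ≠ 0) (v : Fin 2 → ι → MvPolynomial ι K) {i : ι}
    {α : MvPolynomial ι K} (hv : ∀ j, v 1 j = if j = i then α else 0) {G H R : MvPolynomial ι K}
    (hG : G = X i ^ q * H + R) (hH : i ∉ H.vars) (hR : degreeOf i R < q)
    (Φ : Polynomial (MvPolynomial ι K) →+* Polynomial (MvPolynomial ι K))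
    (hC : ∀ c : K, Φ (Polynomial.C (C c)) = Polynomial.C (C c))
    (hX : ∀ j, Φ (Polynomial.C (X j))
      = Polynomial.C (X j) + ∑ t, Polynomial.X ^ (![1, q] : Fin 2 → ℕ) t * Polynomial.C (v t j))
    (hΦ : Φ (Polynomial.C G) = Polynomial.C G) :
    H * α ^ q = - ∑ l ∈ Finset.range q,
      coeff (Finsupp.single 0 (q * q - q * l) + Finsupp.single 1 l) (multiShift v G) := by
  have hdiag : diag ![1, q] (multiShift v G) = Polynomial.C G := by
    rw [diag_multiShift, ← map_C_eq_orderShift _ v Φ hC hX G, hΦ]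
  rw [← coeff_multiShift_single 1 v hv hG hH hR]
  exact coeff_single_eq_neg_sum_of_diag_eq_C hq hdiag

/-- (ours, bookkeeping) Ideal form: under the same hypotheses, if the lower coefficients `Ψ_{(q(q-l), l)}`, `l < q`,
lie in an ideal `I` then `H * α ^ q ∈ I`. [cite: Lang2002, Ch. IV §1] -/
theorem mul_pow_mem {q : ℕ} (hq : q ≠ 0) (v : Fin 2 → ι → MvPolynomial ι K) {i : ι}
    {α : MvPolynomial ι K} (hv : ∀ j, v 1 j = if j = i then α else 0) {G H R : MvPolynomial ι K}
    (hG : G = X i ^ q * H + R) (hH : i ∉ H.vars) (hR : degreeOf i R < q)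
    (Φ : Polynomial (MvPolynomial ι K) →+* Polynomial (MvPolynomial ι K))
    (hC : ∀ c : K, Φ (Polynomial.C (C c)) = Polynomial.C (C c))
    (hX : ∀ j, Φ (Polynomial.C (X j))
      = Polynomial.C (X j) + ∑ t, Polynomial.X ^ (![1, q] : Fin 2 → ℕ) t * Polynomial.C (v t j))
    (hΦ : Φ (Polynomial.C G) = Polynomial.C G) (I : Ideal (MvPolynomial ι K))
    (hI : ∀ l < q, coeff (Finsupp.single 0 (q * q - q * l) + Finsupp.single 1 l) (multiShift v G) ∈ I) :
    H * α ^ q ∈ I := by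
  rw [mul_pow_eq_neg_sum hq v hv hG hH hR Φ hC hX hΦ]
  exact I.neg_mem (I.sum_mem fun l hl => hI l (Finset.mem_range.1 hl))

end Assembly

/-! ## Smoke test -/

section SmokeTest

/- `q = 2`, one slot `ι = Unit`, `G = X^2`: shifting the slot by `α` along `μ = σ^2` only (`v 0 = 0`, `v 1 = α`)
gives `Ψ_{(0,1)} = 2 X α`, `Ψ_{(2,0)} = 0`, and the top coefficient `Ψ_{(0,2)} = α ^ 2 = H α^2` with `H = 1`. -/
example (α : MvPolynomial Unit ℤ) :
    coeff (Finsupp.single (1 : Fin 2) 2)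
      (multiShift (fun t (_ : Unit) => if t = (1 : Fin 2) then α else 0) (X () ^ 2 : MvPolynomial Unit ℤ))
      = 1 * α ^ 2 :=
  coeff_multiShift_single (ι := Unit) (K := ℤ) 1 _ (i := ()) (α := α) (fun _ => by simp)
    (H := 1) (R := 0) (by simp) (by simp) (by simp)

example : Finsupp.weight (![1, 3] : Fin 2 → ℕ) (Finsupp.single (0 : Fin 2) 2 + Finsupp.single (1 : Fin 2) 4) = 14 := by
  rw [weight_fin_two]; simp

end SmokeTest

end MonomialCurve

end Literature.AlgebraicGeometry.Resolution.WeightedBlowup
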